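import Summits.MatrixMultiplication.OmegaCensus.ThreeSetPellCongruence
import Summits.MatrixMultiplication.OmegaCensus.ThreeSetZ4Z4Cells
import HarnessLib

/-!
# The uniform three-set theorem: NO cube law over ANY `A ↠ ℤ₄ × ℤ₄` (all orders, any `c₀`)

ω-census `pub-omega`, family (b3), seat pub-omega-group gen 18.  Framing: lottery ticket; floor = certified bounds/negative
ranges.  VALUE: ONE kernel theorem about the group-theoretic method (TPP capacity of dihedral-like groups, incl. the
generalised dihedral and dicyclic groups over `A`) closing the whole `ℤ₄²`-quotient column of the Dih/Dic cube-law
classification for EVERY order at once; it supersedes the finite-table capstones `no_mod_one_law_of_onto_z4z4_card_lt_1072 /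
_2080` of gens 14–17 (which remain as the tables' record); NOT progress on ω.

**Theorem (`no_mod_one_law_of_onto_z4z4_uniform`).**  Let `A` be a finite abelian group with a surjection `A →+ ZMod 4 × ZMod 4` and
`G` a dihedral-like group over `A` (`ρ, τ : A → G`, `τa·τb = ρ(c₀ + b − a)`, any `c₀` — so `G ∈ {Dih(A), Dic(A, c₀), …}`).  Then
NO TPP triple `(S, T, U)` of `G` attains `3|S||T||U| + 8 = 8|A|` (the `|A| ≡ 1 (mod 3)` law).  Instances: `ℤ₄ × ℤ₄ × ℤ_n` for
every `n` (`no_mod_one_law_z4_z4_zn`), `ℤ_m × ℤ_n` for all `4 ∣ m, n` (`no_mod_one_law_zm_zn`); and the DICYCLIC law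
`3|S||T||U| + 16 = 8|A|` over every abelian `2`-group `A` with `A/⟨c₀⟩ ↠ ℤ₄²` (`no_dicyclic_law_two_group_of_onto_z4z4`, gen 16's
reduction to the Dih side at `|A|/2`, now discharged at every order).

*Proof.*  A law triple whose coset parts are not balanced makes `A` a union of two cosets of a cyclic group
(`two_cosets_of_mod_one_law_of_not_cube`), impossible over `ℤ₄²`; a balanced one is a CUBE `(c,c | d,d | e,e)` with
`3cde + 1 = |A| ≡ 0 (mod 16)`, so `c, d, e` are odd and two of them have the same TYPE (`≡ ±1` or `≡ ±3 (mod 8)`).  Rotate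
them into the first two places and pass to the three-set shifted form `(W, X, Y)` (`cube_shifted_form_of_law`).  The
type-`Y` character pair `w', w' + 2w` (`three_set_pair_reduction`, gen 17) gives the sums `c = ψ_{w'}(W)`, `a = ψ_{w'}(X)`,
`c', a'` at `w' + 2w` through the profiles, and the identities `c̄ab + cāb + i cab̄ = −i^l`, `c̄'a'b' − c'ā'b' + i c'a'b̄' = −i^{l₂}`.
The THREE-SET PELL CONGRUENCE (`three_set_pell_congr`, gen-17 Conjecture B, proved in `ThreeSetPellCongruence.lean` by a
Jacobi-symbol argument) gives `Re(c̄a) ≡ 0 (mod 4) ∨ Im(c̄a) ≡ 2 (mod 4)` and `Im(c̄'a') ≡ 0 (mod 4) ∨ Re(c̄'a') ≡ 2 (mod 4)`.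
On the other hand the three real characters tie `c'` to `c` (`pair_classes_of_profile`): `c' ≡ ±c (mod 4)` if `|W| ≡ ±1
(mod 8)` and `c' ≡ ±c + 2(1+i) (mod 4)` if `|W| ≡ ±3 (mod 8)`, likewise for `a', a`.  For `W, X` of the SAME type the four
facts are contradictory (`same_type_classes_contra`, a `decide` over `ZMod 4`; in words: the character `χ` of `(ℤ[i]/4)ˣ`
with kernel `⟨2 + i⟩` has `χ(c̄a) = −1`, `χ(c̄'a') = +1` by the two congruences but `χ(c')χ(c) = χ(a')χ(a)` for equal types).  ∎

This is the `Y ∪ W`-pair CONJECTURE A of FAMILY-B-ADDENDUM-g17 §5 in its cleanest form (only the `Y` pair is needed: among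
three odd parts two always share a type).
-/

namespace Summit.MatrixMultiplication.OmegaCensus

open Finset

/-! ## Finite arithmetic -/

/-- **The same-type contradiction** (type `±1`: `δ = 0`; type `±3`: `δ = 2`).  `c, d` odd Gaussian residues mod `4`,
`c' = ±c + δ(1+i)`, `d' = ±d + δ(1+i)`; then `Re(c̄d) = 0 ∨ Im(c̄d) = 2` and `Im(c̄'d') = 0 ∨ Re(c̄'d') = 2` cannot both hold.
[folklore] -/
theorem same_type_classes_contra : ∀ (c₁ c₂ d₁ d₂ σ σ' δ : ZMod 4),
    2 * (c₁ + c₂) = 2 → 2 * (d₁ + d₂) = 2 → (σ = 1 ∨ σ = -1) → (σ' = 1 ∨ σ' = -1) → (δ = 0 ∨ δ = 2) →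
    (c₁ * d₁ + c₂ * d₂ = 0 ∨ c₁ * d₂ - c₂ * d₁ = 2) →
    ((σ * c₁ + δ) * (σ' * d₂ + δ) - (σ * c₂ + δ) * (σ' * d₁ + δ) = 0 ∨
      (σ * c₁ + δ) * (σ' * d₁ + δ) + (σ * c₂ + δ) * (σ' * d₂ + δ) = 2) → False := by
  decide

/-- **Classes of the character pair from the profile.**  For a set with profile `P_j, M_j` (`j ∈ ZMod 4`: value of `⟨w', ·⟩`;
`P`/`M`: `⟨w, ·⟩` even/odd) obeying the three real-character equations, the sums `c = ψ_{w'}`, `c' = ψ_{w'+2w}` satisfy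
`c' ≡ ±c (mod 4)` when the size is `≡ ±1 (mod 8)` and `c' ≡ ±c + 2(1+i) (mod 4)` when it is `≡ ±3 (mod 8)`. [folklore] -/
theorem pair_classes_of_profile (P₀ M₀ P₁ M₁ P₂ M₂ P₃ M₃ t : ℕ) (ht : P₀ + M₀ + P₁ + M₁ + P₂ + M₂ + P₃ + M₃ = t)
    (hA : ((P₀ + M₀ : ℕ) : ℤ) - (P₁ + M₁ : ℕ) + (P₂ + M₂ : ℕ) - (P₃ + M₃ : ℕ) = 1 ∨
      ((P₀ + M₀ : ℕ) : ℤ) - (P₁ + M₁ : ℕ) + (P₂ + M₂ : ℕ) - (P₃ + M₃ : ℕ) = -1)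
    (hB1 : ((P₀ : ℤ) - M₀) + ((P₁ : ℤ) - M₁) + ((P₂ : ℤ) - M₂) + ((P₃ : ℤ) - M₃) = 1 ∨
      ((P₀ : ℤ) - M₀) + ((P₁ : ℤ) - M₁) + ((P₂ : ℤ) - M₂) + ((P₃ : ℤ) - M₃) = -1)
    (hB2 : ((P₀ : ℤ) - M₀) - ((P₁ : ℤ) - M₁) + ((P₂ : ℤ) - M₂) - ((P₃ : ℤ) - M₃) = 1 ∨
      ((P₀ : ℤ) - M₀) - ((P₁ : ℤ) - M₁) + ((P₂ : ℤ) - M₂) - ((P₃ : ℤ) - M₃) = -1) :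
    ((t % 8 = 1 ∨ t % 8 = 7) →
      (((((P₀ : ℤ) - M₀) - ((P₂ : ℤ) - M₂)) - (((P₀ + M₀ : ℕ) : ℤ) - (P₂ + M₂ : ℕ))) % 4 = 0 ∧
        ((((P₁ : ℤ) - M₁) - ((P₃ : ℤ) - M₃)) - (((P₁ + M₁ : ℕ) : ℤ) - (P₃ + M₃ : ℕ))) % 4 = 0) ∨
      (((((P₀ : ℤ) - M₀) - ((P₂ : ℤ) - M₂)) + (((P₀ + M₀ : ℕ) : ℤ) - (P₂ + M₂ : ℕ))) % 4 = 0 ∧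
        ((((P₁ : ℤ) - M₁) - ((P₃ : ℤ) - M₃)) + (((P₁ + M₁ : ℕ) : ℤ) - (P₃ + M₃ : ℕ))) % 4 = 0)) ∧
    ((t % 8 = 3 ∨ t % 8 = 5) →
      (((((P₀ : ℤ) - M₀) - ((P₂ : ℤ) - M₂)) - (((P₀ + M₀ : ℕ) : ℤ) - (P₂ + M₂ : ℕ))) % 4 = 2 ∧
        ((((P₁ : ℤ) - M₁) - ((P₃ : ℤ) - M₃)) - (((P₁ + M₁ : ℕ) : ℤ) - (P₃ + M₃ : ℕ))) % 4 = 2) ∨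
      (((((P₀ : ℤ) - M₀) - ((P₂ : ℤ) - M₂)) + (((P₀ + M₀ : ℕ) : ℤ) - (P₂ + M₂ : ℕ))) % 4 = 2 ∧
        ((((P₁ : ℤ) - M₁) - ((P₃ : ℤ) - M₃)) + (((P₁ + M₁ : ℕ) : ℤ) - (P₃ + M₃ : ℕ))) % 4 = 2)) := by
  push_cast at hA ⊢
  omega

/-- Transfer `x % 4 = c` to `ZMod 4`. [folklore] -/
theorem zmod4_eq_of_emod {x c : ℤ} (hc : 0 ≤ c) (hc4 : c < 4) (h : x % 4 = c) : (x : ZMod 4) = (c : ZMod 4) := by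
  rw [ZMod.intCast_eq_intCast_iff']
  push_cast
  omega

/-- `(u − v) % 4 = c` ⇒ `u = v + c` in `ZMod 4`. [folklore] -/
theorem zmod4_eq_add_of_sub_emod {u v c : ℤ} (hc : 0 ≤ c) (hc4 : c < 4) (h : (u - v) % 4 = c) :
    (u : ZMod 4) = 1 * (v : ZMod 4) + (c : ZMod 4) := by
  have := zmod4_eq_of_emod hc hc4 h
  push_cast at this
  linear_combination this

/-- `(u + v) % 4 = c` ⇒ `u = −v + c` in `ZMod 4`. [folklore] -/
theorem zmod4_eq_neg_add_of_add_emod {u v c : ℤ} (hc : 0 ≤ c) (hc4 : c < 4) (h : (u + v) % 4 = c) :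
    (u : ZMod 4) = -1 * (v : ZMod 4) + (c : ZMod 4) := by
  have := zmod4_eq_of_emod hc hc4 h
  push_cast at this
  linear_combination this

/-- **Parities from the real character `2w'`**: `c = ψ_{w'}` and `c' = ψ_{w'+2w}` are odd Gaussian integers. [folklore] -/
theorem pair_sums_parity (P₀ M₀ P₁ M₁ P₂ M₂ P₃ M₃ : ℕ)
    (hA : ((P₀ + M₀ : ℕ) : ℤ) - (P₁ + M₁ : ℕ) + (P₂ + M₂ : ℕ) - (P₃ + M₃ : ℕ) = 1 ∨
      ((P₀ + M₀ : ℕ) : ℤ) - (P₁ + M₁ : ℕ) + (P₂ + M₂ : ℕ) - (P₃ + M₃ : ℕ) = -1) :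
    Odd ((((P₀ + M₀ : ℕ) : ℤ) - (P₂ + M₂ : ℕ)) + (((P₁ + M₁ : ℕ) : ℤ) - (P₃ + M₃ : ℕ))) ∧
    Odd ((((P₀ : ℤ) - M₀) - ((P₂ : ℤ) - M₂)) + (((P₁ : ℤ) - M₁) - ((P₃ : ℤ) - M₃))) ∧
    (2 * ((((P₀ + M₀ : ℕ) : ℤ) - (P₂ + M₂ : ℕ)) + (((P₁ + M₁ : ℕ) : ℤ) - (P₃ + M₃ : ℕ)))) % 4 = 2 := by
  refine ⟨Int.odd_iff.2 ?_, Int.odd_iff.2 ?_, ?_⟩ <;> push_cast at hA ⊢ <;> omega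

/-- **The same-type contradiction, integer form.**  `m + n i`, `a₁ + a₂ i` odd; `m' + n' i = ±(m + n i) + δ(1+i)`,
`a₁' + a₂' i = ±(a₁ + a₂ i) + δ(1+i)` (mod `4`) with one `δ ∈ {0, 2}`; then the two Pell congruences are contradictory.
[folklore] -/
theorem same_type_contra_int {m n a₁ a₂ m' n' a₁' a₂' : ℤ} {δ : ℤ} (hδ : δ = 0 ∨ δ = 2)
    (hc2 : (2 * (m + n)) % 4 = 2) (ha2 : (2 * (a₁ + a₂)) % 4 = 2)
    (brW : ((m' - m) % 4 = δ ∧ (n' - n) % 4 = δ) ∨ ((m' + m) % 4 = δ ∧ (n' + n) % 4 = δ))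
    (brX : ((a₁' - a₁) % 4 = δ ∧ (a₂' - a₂) % 4 = δ) ∨ ((a₁' + a₁) % 4 = δ ∧ (a₂' + a₂) % 4 = δ))
    (F1 : (m * a₁ + n * a₂) % 4 = 0 ∨ (m * a₂ - n * a₁) % 4 = 2)
    (F2 : (m' * a₂' - n' * a₁') % 4 = 0 ∨ (m' * a₁' + n' * a₂') % 4 = 2) : False := by
  have hδ0 : 0 ≤ δ := by omega
  have hδ4 : δ < 4 := by omega
  have hcz : 2 * ((m : ZMod 4) + (n : ZMod 4)) = 2 := by
    have := zmod4_eq_of_emod (by norm_num) (by norm_num) hc2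
    push_cast at this; exact this
  have haz : 2 * ((a₁ : ZMod 4) + (a₂ : ZMod 4)) = 2 := by
    have := zmod4_eq_of_emod (by norm_num) (by norm_num) ha2
    push_cast at this; exact this
  have hF1 : (m : ZMod 4) * (a₁ : ZMod 4) + (n : ZMod 4) * (a₂ : ZMod 4) = 0 ∨
      (m : ZMod 4) * (a₂ : ZMod 4) - (n : ZMod 4) * (a₁ : ZMod 4) = 2 := by
    rcases F1 with h | h
    · left; have := zmod4_eq_of_emod (by norm_num) (by norm_num) h; push_cast at this; exact this
    · right; have := zmod4_eq_of_emod (by norm_num) (by norm_num) h; push_cast at this; exact this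
  have hF2 : (m' : ZMod 4) * (a₂' : ZMod 4) - (n' : ZMod 4) * (a₁' : ZMod 4) = 0 ∨
      (m' : ZMod 4) * (a₁' : ZMod 4) + (n' : ZMod 4) * (a₂' : ZMod 4) = 2 := by
    rcases F2 with h | h
    · left; have := zmod4_eq_of_emod (by norm_num) (by norm_num) h; push_cast at this; exact this
    · right; have := zmod4_eq_of_emod (by norm_num) (by norm_num) h; push_cast at this; exact this
  have kW : ∃ σ : ZMod 4, (σ = 1 ∨ σ = -1) ∧ (m' : ZMod 4) = σ * m + (δ : ZMod 4) ∧ (n' : ZMod 4) = σ * n + (δ : ZMod 4) := by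
    rcases brW with ⟨h1, h2⟩ | ⟨h1, h2⟩
    · exact ⟨1, Or.inl rfl, zmod4_eq_add_of_sub_emod hδ0 hδ4 h1, zmod4_eq_add_of_sub_emod hδ0 hδ4 h2⟩
    · exact ⟨-1, Or.inr rfl, zmod4_eq_neg_add_of_add_emod hδ0 hδ4 h1, zmod4_eq_neg_add_of_add_emod hδ0 hδ4 h2⟩
  have kX : ∃ σ' : ZMod 4, (σ' = 1 ∨ σ' = -1) ∧
      (a₁' : ZMod 4) = σ' * a₁ + (δ : ZMod 4) ∧ (a₂' : ZMod 4) = σ' * a₂ + (δ : ZMod 4) := by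
    rcases brX with ⟨h1, h2⟩ | ⟨h1, h2⟩
    · exact ⟨1, Or.inl rfl, zmod4_eq_add_of_sub_emod hδ0 hδ4 h1, zmod4_eq_add_of_sub_emod hδ0 hδ4 h2⟩
    · exact ⟨-1, Or.inr rfl, zmod4_eq_neg_add_of_add_emod hδ0 hδ4 h1, zmod4_eq_neg_add_of_add_emod hδ0 hδ4 h2⟩
  obtain ⟨σ, hσ, e1, e2⟩ := kW
  obtain ⟨σ', hσ', e3, e4⟩ := kX
  have hδ' : (δ : ZMod 4) = 0 ∨ (δ : ZMod 4) = 2 := by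
    rcases hδ with rfl | rfl
    · left; push_cast; rfl
    · right; push_cast; rfl
  rw [e1, e2, e3, e4] at hF2
  exact same_type_classes_contra _ _ _ _ σ σ' _ hcz haz hσ hσ' hδ' hF1 hF2

/-! ## Core: no three-set form with `W`, `X` of the same type -/

section Core

variable {A : Type*} [AddCommGroup A] [Fintype A] [DecidableEq A]

/-- **No three-set shifted form over `A ↠ ℤ₄²` whose parts `W`, `X` have the same type** (`|W|, |X|` both `≡ ±1` or both
`≡ ±3 (mod 8)`), `Y` arbitrary. [folklore] -/
theorem no_cube_form_same_type_of_onto_z4z4 (Φ : A →+ ZMod 4 × ZMod 4) (hΦ : Function.Surjective Φ)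
    {W X Y : Finset A} {κ₁ κ₂ κ₃ x₀ : A}
    (htype : ((W.card % 8 = 1 ∨ W.card % 8 = 7) ∧ (X.card % 8 = 1 ∨ X.card % 8 = 7)) ∨
      ((W.card % 8 = 3 ∨ W.card % 8 = 5) ∧ (X.card % 8 = 3 ∨ X.card % 8 = 5)))
    (i₁ : Set.InjOn (fun p : A × A × A => p.1 + p.2.1 + p.2.2) ↑((W.image fun w => κ₁ - w) ×ˢ X ×ˢ Y))
    (i₂ : Set.InjOn (fun p : A × A × A => p.1 + p.2.1 + p.2.2) ↑(W ×ˢ (X.image fun x => κ₂ - x) ×ˢ Y))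
    (i₃ : Set.InjOn (fun p : A × A × A => p.1 + p.2.1 + p.2.2) ↑(W ×ˢ X ×ˢ (Y.image fun y => κ₃ - y)))
    (d₁₂ : Disjoint (((W.image fun w => κ₁ - w) ×ˢ X ×ˢ Y).image fun p : A × A × A => p.1 + p.2.1 + p.2.2)
      ((W ×ˢ (X.image fun x => κ₂ - x) ×ˢ Y).image fun p : A × A × A => p.1 + p.2.1 + p.2.2))
    (d₁₃ : Disjoint (((W.image fun w => κ₁ - w) ×ˢ X ×ˢ Y).image fun p : A × A × A => p.1 + p.2.1 + p.2.2)
      ((W ×ˢ X ×ˢ (Y.image fun y => κ₃ - y)).image fun p : A × A × A => p.1 + p.2.1 + p.2.2))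
    (d₂₃ : Disjoint ((W ×ˢ (X.image fun x => κ₂ - x) ×ˢ Y).image fun p : A × A × A => p.1 + p.2.1 + p.2.2)
      ((W ×ˢ X ×ˢ (Y.image fun y => κ₃ - y)).image fun p : A × A × A => p.1 + p.2.1 + p.2.2))
    (hcover : (((W.image fun w => κ₁ - w) ×ˢ X ×ˢ Y).image fun p : A × A × A => p.1 + p.2.1 + p.2.2) ∪
      ((W ×ˢ (X.image fun x => κ₂ - x) ×ˢ Y).image fun p : A × A × A => p.1 + p.2.1 + p.2.2) ∪
      ((W ×ˢ X ×ˢ (Y.image fun y => κ₃ - y)).image fun p : A × A × A => p.1 + p.2.1 + p.2.2) = univ.erase x₀) :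
    False := by
  obtain ⟨P₀, M₀, P₁, M₁, P₂, M₂, P₃, M₃, S₀, T₀, S₁, T₁, S₂, T₂, S₃, T₃, l, l₂, b, b', hsW, hsX, hAW, hB1W, hB2W,
    hAX, hB1X, hB2X, -, E1, E2⟩ := three_set_pair_reduction Φ hΦ i₁ i₂ i₃ d₁₂ d₁₃ d₂₃ hcover
  -- classes of `(c, c')` and `(a, a')`
  obtain ⟨brW1, brW3⟩ := pair_classes_of_profile P₀ M₀ P₁ M₁ P₂ M₂ P₃ M₃ W.card hsW hAW hB1W hB2W
  obtain ⟨brX1, brX3⟩ := pair_classes_of_profile S₀ T₀ S₁ T₁ S₂ T₂ S₃ T₃ X.card hsX hAX hB1X hB2X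
  -- parities of the sums, the two Pell congruences, the contradiction
  obtain ⟨hc, hc', hc2⟩ := pair_sums_parity P₀ M₀ P₁ M₁ P₂ M₂ P₃ M₃ hAW
  obtain ⟨ha, ha', ha2⟩ := pair_sums_parity S₀ T₀ S₁ T₁ S₂ T₂ S₃ T₃ hAX
  have F1 := three_set_pell_congr hc ha E1
  have F2 := three_set_pell_congr_neg hc' ha' E2
  rcases htype with ⟨hW, hX⟩ | ⟨hW, hX⟩
  · exact same_type_contra_int (δ := 0) (Or.inl rfl) hc2 ha2 (brW1 hW) (brX1 hX) F1 F2
  · exact same_type_contra_int (δ := 2) (Or.inr rfl) hc2 ha2 (brW3 hW) (brX3 hX) F1 F2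

end Core

/-! ## The TPP statements and the capstone -/

section DihedralLike

variable {A : Type} [AddCommGroup A] [DecidableEq A] [Fintype A] {G : Type} [Group G] [DecidableEq G]
  {ρ τ : A → G} {c₀ : A} {S T U : Finset G}

open Literature.Combinatorics.Additive

/-- **No same-type cube law triple over `A ↠ ℤ₄ × ℤ₄`.**  Dihedral-like `G` over `A` (any `c₀`), `Φ : A →+ ZMod 4 × ZMod 4`
onto; a TPP triple with balanced coset parts whose `S`- and `T`-parts are both `≡ ±1` or both `≡ ±3 (mod 8)`.  Then
`3|S||T||U| + 8 ≠ 8|A|`. [folklore] -/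
theorem no_law_cube_same_type_of_onto_z4z4
    (hρρ : ∀ a b, ρ a * ρ b = ρ (a + b)) (hρτ : ∀ a b, ρ a * τ b = τ (b - a))
    (hτρ : ∀ a b, τ a * ρ b = τ (a + b)) (hττ : ∀ a b, τ a * τ b = ρ (c₀ + b - a))
    (hρ : Function.Injective ρ) (hτ : Function.Injective τ) (hne : ∀ a b, ρ a ≠ τ b)
    (hsurj : ∀ g, (∃ a, ρ a = g) ∨ (∃ a, τ a = g))
    (Φ : A →+ ZMod 4 × ZMod 4) (hΦ : Function.Surjective Φ)
    (h : TripleProductProperty S T U)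
    (hS : (univ.filter fun a : A => ρ a ∈ S).card = (univ.filter fun a : A => τ a ∈ S).card)
    (hT : (univ.filter fun a : A => ρ a ∈ T).card = (univ.filter fun a : A => τ a ∈ T).card)
    (hU : (univ.filter fun a : A => ρ a ∈ U).card = (univ.filter fun a : A => τ a ∈ U).card)
    (htype : (((univ.filter fun a : A => ρ a ∈ S).card % 8 = 1 ∨ (univ.filter fun a : A => ρ a ∈ S).card % 8 = 7) ∧
        ((univ.filter fun a : A => ρ a ∈ T).card % 8 = 1 ∨ (univ.filter fun a : A => ρ a ∈ T).card % 8 = 7)) ∨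
      (((univ.filter fun a : A => ρ a ∈ S).card % 8 = 3 ∨ (univ.filter fun a : A => ρ a ∈ S).card % 8 = 5) ∧
        ((univ.filter fun a : A => ρ a ∈ T).card % 8 = 3 ∨ (univ.filter fun a : A => ρ a ∈ T).card % 8 = 5)))
    (hV : 3 * (S.card * T.card * U.card) + 8 = 8 * Fintype.card A) : False := by
  classical
  obtain ⟨W, X, Y, κ₁, κ₂, κ₃, x₀, hWc, hXc, -, -, i₁, i₂, i₃, d₁₂, d₁₃, d₂₃, hcover⟩ :=
    cube_shifted_form_of_law hρρ hρτ hτρ hττ hρ hτ hne hsurj h hS hT hU hV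
  rw [← hWc, ← hXc] at htype
  exact no_cube_form_same_type_of_onto_z4z4 Φ hΦ htype i₁ i₂ i₃ d₁₂ d₁₃ d₂₃ hcover

/-- **THE `ℤ₄²`-QUOTIENT COLUMN, ALL ORDERS.**  Let `A` be a finite abelian group with a surjection
`φ : A →+ ZMod 4 × ZMod 4`, and `G` a dihedral-like group over `A` (any `c₀`: generalised dihedral, dicyclic, …).  Then no
TPP triple of `G` attains `3|S||T||U| + 8 = 8|A|`. [folklore] -/
theorem no_mod_one_law_of_onto_z4z4_uniform
    (hρρ : ∀ a b, ρ a * ρ b = ρ (a + b)) (hρτ : ∀ a b, ρ a * τ b = τ (b - a))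
    (hτρ : ∀ a b, τ a * ρ b = τ (a + b)) (hττ : ∀ a b, τ a * τ b = ρ (c₀ + b - a))
    (hρ : Function.Injective ρ) (hτ : Function.Injective τ) (hne : ∀ a b, ρ a ≠ τ b)
    (hsurj : ∀ g, (∃ a, ρ a = g) ∨ (∃ a, τ a = g))
    (φ : A →+ ZMod 4 × ZMod 4) (hφ : Function.Surjective φ)
    (h : TripleProductProperty S T U) : 3 * (S.card * T.card * U.card) + 8 ≠ 8 * Fintype.card A := by
  intro hV
  have h16 : 16 ∣ Fintype.card A := sixteen_dvd_card_of_onto_z4z4 φ hφ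
  have hpos : 0 < Fintype.card A := Fintype.card_pos
  have hA : 14 ≤ Fintype.card A := by obtain ⟨k, hk⟩ := h16; omega
  have hmod : Fintype.card A % 3 = 1 := by omega
  by_cases hnc : ((univ.filter fun a : A => ρ a ∈ S).card = (univ.filter fun a : A => τ a ∈ S).card ∧
      (univ.filter fun a : A => ρ a ∈ T).card = (univ.filter fun a : A => τ a ∈ T).card ∧
      (univ.filter fun a : A => ρ a ∈ U).card = (univ.filter fun a : A => τ a ∈ U).card)
  · obtain ⟨hS', hT', hU'⟩ := hnc
    have cS := card_eq_parts' hρ hτ hne hsurj S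
    have cT := card_eq_parts' hρ hτ hne hsurj T
    have cU := card_eq_parts' hρ hτ hne hsurj U
    set s₀ := (univ.filter fun a : A => ρ a ∈ S).card with hs₀
    set t₀ := (univ.filter fun a : A => ρ a ∈ T).card with ht₀
    set u₀ := (univ.filter fun a : A => ρ a ∈ U).card with hu₀
    have eS : S.card = 2 * s₀ := by rw [cS, ← hS']; ring
    have eT : T.card = 2 * t₀ := by rw [cT, ← hT']; ring
    have eU : U.card = 2 * u₀ := by rw [cU, ← hU']; ring
    have hprod : 3 * (s₀ * t₀ * u₀) + 1 = Fintype.card A := by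
      rw [eS, eT, eU] at hV; nlinarith
    -- the three parts are odd
    have hodd : Odd (s₀ * t₀ * u₀) := by
      set P := s₀ * t₀ * u₀ with hP
      exact Nat.odd_iff.2 (by omega)
    obtain ⟨hst, hu⟩ := Nat.odd_mul.1 hodd
    obtain ⟨hs, ht⟩ := Nat.odd_mul.1 hst
    have hs' := Nat.odd_iff.1 hs
    have ht' := Nat.odd_iff.1 ht
    have hu' := Nat.odd_iff.1 hu
    -- two of them have the same type
    have key : (((s₀ % 8 = 1 ∨ s₀ % 8 = 7) ∧ (t₀ % 8 = 1 ∨ t₀ % 8 = 7)) ∨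
          ((s₀ % 8 = 3 ∨ s₀ % 8 = 5) ∧ (t₀ % 8 = 3 ∨ t₀ % 8 = 5))) ∨
        (((t₀ % 8 = 1 ∨ t₀ % 8 = 7) ∧ (u₀ % 8 = 1 ∨ u₀ % 8 = 7)) ∨
          ((t₀ % 8 = 3 ∨ t₀ % 8 = 5) ∧ (u₀ % 8 = 3 ∨ u₀ % 8 = 5))) ∨
        (((u₀ % 8 = 1 ∨ u₀ % 8 = 7) ∧ (s₀ % 8 = 1 ∨ s₀ % 8 = 7)) ∨
          ((u₀ % 8 = 3 ∨ u₀ % 8 = 5) ∧ (s₀ % 8 = 3 ∨ s₀ % 8 = 5))) := by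
      omega
    rcases key with hst | htu | hus
    · exact no_law_cube_same_type_of_onto_z4z4 hρρ hρτ hτρ hττ hρ hτ hne hsurj φ hφ h hS' hT' hU' hst hV
    · exact no_law_cube_same_type_of_onto_z4z4 hρρ hρτ hτρ hττ hρ hτ hne hsurj φ hφ h.rotate hT' hU' hS' htu
        (by rw [← hV]; ring)
    · exact no_law_cube_same_type_of_onto_z4z4 hρρ hρτ hτρ hττ hρ hτ hne hsurj φ hφ h.rotate.rotate hU' hS' hT' hus
        (by rw [← hV]; ring)
  · obtain ⟨g, a, b, hab⟩ :=
      two_cosets_of_mod_one_law_of_not_cube hρρ hρτ hτρ hττ hρ hτ hne hsurj hmod hA h hV hnc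
    exact not_two_cosets_of_onto_z4z4 φ hφ g a b hab

/-- **Dicyclic side, every abelian `2`-group.**  Dicyclic type `G(A, c₀)` (`c₀ ≠ 0`) over a finite abelian `2`-group `A`
with `Φ : A →+ ZMod 4 × ZMod 4` onto and `Φ c₀ = 0` (i.e. `A/⟨c₀⟩ ↠ ℤ₄²`).  Then no TPP triple attains the dicyclic law
`3|S||T||U| + 16 = 8|A|` — gen 16's reduction `no_dicyclic_law_of_onto_z4z4_of_dih` with its Dih-side hypothesis at `|A|/2`
discharged for EVERY order by `no_mod_one_law_of_onto_z4z4_uniform` (previously unconditional only at `|A| = 32, 128, 512`).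
[folklore] -/
theorem no_dicyclic_law_two_group_of_onto_z4z4
    (hρρ : ∀ a b, ρ a * ρ b = ρ (a + b)) (hρτ : ∀ a b, ρ a * τ b = τ (b - a))
    (hτρ : ∀ a b, τ a * ρ b = τ (a + b)) (hττ : ∀ a b, τ a * τ b = ρ (c₀ + b - a)) (hc₀ : c₀ ≠ 0)
    (hρ : Function.Injective ρ) (hτ : Function.Injective τ) (hne : ∀ a b, ρ a ≠ τ b)
    (hsurj : ∀ g, (∃ a, ρ a = g) ∨ (∃ a, τ a = g)) {k : ℕ} (hA2 : ∀ a : A, (2 ^ k) • a = 0)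
    (Φ : A →+ ZMod 4 × ZMod 4) (hΦ : Function.Surjective Φ) (hΦc : Φ c₀ = 0)
    (h : TripleProductProperty S T U) : 3 * (S.card * T.card * U.card) + 16 ≠ 8 * Fintype.card A := by
  have h16 : 16 ∣ Fintype.card A := sixteen_dvd_card_of_onto_z4z4 Φ hΦ
  obtain ⟨n, hn⟩ : ∃ n, Fintype.card A = 2 * n := ⟨Fintype.card A / 2, by omega⟩
  exact no_dicyclic_law_of_onto_z4z4_of_dih hρρ hρτ hτρ hττ hc₀ hρ hτ hne hsurj hn
    (fun _ _ _ _ _ _ _ _ _ _ h₁ h₂ h₃ h₄ h₅ h₆ h₇ h₈ _ φ hφ _ _ _ hT =>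
      no_mod_one_law_of_onto_z4z4_uniform h₁ h₂ h₃ h₄ h₅ h₆ h₇ h₈ φ hφ hT) hA2 Φ hΦ hΦc h

end DihedralLike

/-! ## Instances: whole families of orders -/

section Instances

variable {G : Type} [Group G] [DecidableEq G] {S T U : Finset G}

open Literature.Combinatorics.Additive

/-- **`ℤ₄ × ℤ₄ × ℤ_n`, every `n ≥ 1`**: no dihedral-like group over it (any `c₀`) has a TPP triple with
`3|S||T||U| + 8 = 8·16n`. [folklore] -/
theorem no_mod_one_law_z4_z4_zn (n : ℕ) [NeZero n] {ρ τ : ZMod 4 × (ZMod 4 × ZMod n) → G}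
    {c₀ : ZMod 4 × (ZMod 4 × ZMod n)}
    (hρρ : ∀ a b, ρ a * ρ b = ρ (a + b)) (hρτ : ∀ a b, ρ a * τ b = τ (b - a))
    (hτρ : ∀ a b, τ a * ρ b = τ (a + b)) (hττ : ∀ a b, τ a * τ b = ρ (c₀ + b - a))
    (hρ : Function.Injective ρ) (hτ : Function.Injective τ) (hne : ∀ a b, ρ a ≠ τ b)
    (hsurj : ∀ g, (∃ a, ρ a = g) ∨ (∃ a, τ a = g)) (h : TripleProductProperty S T U) :
    3 * (S.card * T.card * U.card) + 8 ≠ 8 * Fintype.card (ZMod 4 × (ZMod 4 × ZMod n)) :=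
  no_mod_one_law_of_onto_z4z4_uniform hρρ hρτ hτρ hττ hρ hτ hne hsurj _ (z4_z4_zn_onto_z4z4 n) h

/-- **`ℤ_m × ℤ_n` with `4 ∣ m`, `4 ∣ n`** (all abelian groups of rank two with a `ℤ₄²` quotient, e.g. `ℤ₄ × ℤ₃₀₄`,
`ℤ₈ × ℤ₁₅₂`, `ℤ₁₆²`, …): no dihedral-like group over it (any `c₀`) has a TPP triple with `3|S||T||U| + 8 = 8mn`. [folklore] -/
theorem no_mod_one_law_zm_zn {m n : ℕ} [NeZero m] [NeZero n] (hm : 4 ∣ m) (hn : 4 ∣ n)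
    {ρ τ : ZMod m × ZMod n → G} {c₀ : ZMod m × ZMod n}
    (hρρ : ∀ a b, ρ a * ρ b = ρ (a + b)) (hρτ : ∀ a b, ρ a * τ b = τ (b - a))
    (hτρ : ∀ a b, τ a * ρ b = τ (a + b)) (hττ : ∀ a b, τ a * τ b = ρ (c₀ + b - a))
    (hρ : Function.Injective ρ) (hτ : Function.Injective τ) (hne : ∀ a b, ρ a ≠ τ b)
    (hsurj : ∀ g, (∃ a, ρ a = g) ∨ (∃ a, τ a = g)) (h : TripleProductProperty S T U) :
    3 * (S.card * T.card * U.card) + 8 ≠ 8 * Fintype.card (ZMod m × ZMod n) :=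
  no_mod_one_law_of_onto_z4z4_uniform hρρ hρτ hτρ hττ hρ hτ hne hsurj _ (zm_zn_onto_z4z4 hm hn) h

end Instances

end Summit.MatrixMultiplication.OmegaCensus
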